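import Mathlib.Topology.UrysohnsLemma
import Mathlib.Topology.MetricSpace.HausdorffDistance
import Mathlib.MeasureTheory.Function.LocallyIntegrable
import Literature.Geometry.Lorentzian.LateTimeOmegaLimitSet
import HarnessLib

/-!
# Defect data of stationary (eventually constant) Burnett sequences vanish

Huneau–Luk's defect-measure datum (`IsBurnettDefectDatum`, consequence form of arXiv:2403.03470,
Def. 4.1 with (1.5)) records the second fibre moments `∫ φ(x) ω(v) ω(w) dμ` as limits of the
quadratic expressions `∫ φ Q_{g₀}(∂(gₙ − g₀), ∂(gₙ − g₀)) dVol_{g₀}`. For a CONSTANT sequence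
`gₙ = G₀` whose Burnett limit agrees with `G₀` on the (open) chart domain `U` these expressions
vanish identically, so all second moments vanish; summing the diagonal moments over an
orthonormal basis (Parseval on the unit cosphere, `Σᵢ ω(eᵢ)² = |ω|² = 1`) gives `∫ φ ∘ pr₁ dμ = 0`
for every admissible test function, whence `μ = 0` (Urysohn functions and a compact exhaustion of
`U`). Consequence for late-time ω-limit sets (`Spacetime.lateTimeBurnettDefectOmegaLimitSet`): a
chart whose translates `g_T` do not depend on `T` (a stationary spacetime read through a
stationary chart, e.g. Kerr through its Kerr–Schild chart) has the single ω-limit `(G₀, 0)` on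
every open slab — no effective Vlasov matter ("the limit may well be vacuum", HL 2024, §1), the
first sanity check of every stationary witness for the cruxes LateTimeBurnettIdentification /
OmegaLimitsNonRadiating of route BurnettKineticRigidity (final state conjecture).

## Main statements

* `sum_cosphereSecondMoment_eq_integral`: `Σᵢ ∫ φ ω(bᵢ)² dμ = ∫ φ ∘ pr₁ dμ` for an orthonormal
  basis `b` (Radon `μ`, `φ ∈ C_c`).
* `IsBurnettDefectDatum.integral_eq_zero_of_eqOn`, `….measure_prod_eq_zero_of_eqOn`,
  `….eq_zero_of_eqOn`, `….eq_zero_of_const`: for `gₙ = G₀` constant, `U` open and the limit `g`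
  equal to `G₀` on `U`, the datum is the zero measure.
* `ModelBackground.isOpen_image_timeSlabIoo`: slabs of a background with continuous time function
  are open in `E4` (the Kerr–Schild instance is `isOpen_image_val_timeSlabIoo_kerr_background` of
  `Summits/…/Theorems/BurnettKineticRigidityLateTimeBurnettPrecompactness.lean`).
* `Spacetime.eqOn_and_eq_zero_of_mem_lateTimeBurnettDefectOmegaLimitSet`: if `g_T = G₀` for all
  `T`, every `(g, μ)` in the late-time Burnett ω-limit set with defect measures on an open slab has
  `g = G₀` on the slab and `μ = 0`.

## References

* C. Huneau, J. Luk, arXiv:2403.03470, Def. 4.1, (1.5), §1. [HuneauLuk2024wave]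
-/

noncomputable section

-- nested operator spaces `E →L[ℝ] E →L[ℝ] E →L[ℝ] ℝ`, as in `BurnettDefectMeasure.lean`
set_option maxSynthPendingDepth 3

open Set Filter Topology MeasureTheory
open scoped Topology RealInnerProductSpace ENNReal

namespace Literature.Geometry.Lorentzian

section Datum

variable {E : Type*} [NormedAddCommGroup E] [InnerProductSpace ℝ E] [FiniteDimensional ℝ E]
  [MeasurableSpace E] [BorelSpace E]

omit [MeasurableSpace E] [BorelSpace E] in
/-- A test function of the base point has compact support on the cosphere bundle `E × S(E)`
(the fibre is compact). [folklore] -/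
theorem hasCompactSupport_comp_fst_cosphere {φ : E → ℝ} (hφc : HasCompactSupport φ) :
    HasCompactSupport (fun p : E × Metric.sphere (0 : E) 1 ↦ φ p.1) := by
  have hsub : Function.support (fun p : E × Metric.sphere (0 : E) 1 ↦ φ p.1) ⊆
      tsupport φ ×ˢ (univ : Set (Metric.sphere (0 : E) 1)) := fun p hp ↦
    ⟨subset_tsupport _ (Function.mem_support.2 (Function.mem_support.1 hp)), mem_univ _⟩
  exact IsCompact.of_isClosed_subset (hφc.prod isCompact_univ) (isClosed_tsupport _)
    (closure_minimal hsub ((isClosed_tsupport _).prod isClosed_univ))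

/-- **Parseval on the unit cosphere**: for an orthonormal basis `b` of `E`, a Radon measure `μ`
on `E × S(E)` and `φ ∈ C_c(E)`, `Σᵢ ∫ φ(x) ω(bᵢ)² dμ(x, ω) = ∫ φ(x) dμ(x, ω)` — the trace of the
second fibre moments is the push-forward of `μ` to the base (`Σᵢ ω(bᵢ)² = |ω|² = 1`; HL 2019,
Rem. 4.3: `tr T = ∫ |ξ|² dμ_x`). [cite: HuneauLuk2024wave, Definition 4.1] -/
theorem sum_cosphereSecondMoment_eq_integral {ι : Type*} [Fintype ι] (b : OrthonormalBasis ι ℝ E)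
    (μ : Measure (E × Metric.sphere (0 : E) 1)) [IsFiniteMeasureOnCompacts μ] {φ : E → ℝ}
    (hφ : Continuous φ) (hφc : HasCompactSupport φ) :
    ∑ i, cosphereSecondMoment μ φ (b i) (b i) = ∫ p, φ p.1 ∂μ := by
  have hint : ∀ i, Integrable (fun p : E × Metric.sphere (0 : E) 1 ↦
      φ p.1 * (⟪(p.2 : E), b i⟫ * ⟪(p.2 : E), b i⟫)) μ := fun i ↦
    Continuous.integrable_of_hasCompactSupport (by fun_prop)
      ((hasCompactSupport_comp_fst_cosphere hφc).mul_right)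
  simp only [cosphereSecondMoment_apply]
  rw [← integral_finsetSum _ fun i _ ↦ hint i]
  refine integral_congr_ae (Eventually.of_forall fun p ↦ ?_)
  have h1 : ∑ i, ⟪(p.2 : E), b i⟫ * ⟪(p.2 : E), b i⟫ = 1 := by
    have h := b.sum_sq_inner_left (p.2 : E)
    simp only [sq, norm_eq_of_mem_sphere p.2, one_mul] at h
    exact h
  show ∑ i, φ p.1 * (⟪(p.2 : E), b i⟫ * ⟪(p.2 : E), b i⟫) = φ p.1
  rw [← Finset.mul_sum, h1, mul_one]

namespace IsBurnettDefectDatum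

variable {U : Set E} {G₀ g : E → E →L[ℝ] E →L[ℝ] ℝ} {μ : Measure (E × Metric.sphere (0 : E) 1)}

/-- Along a **constant** sequence `gₙ = G₀` whose limit `g` agrees with `G₀` on the open set `U`,
Huneau–Luk's quadratic expressions vanish identically, so every second fibre moment of a datum
vanishes: `∫ φ(x) ω(v) ω(w) dμ = 0`. [cite: HuneauLuk2024wave, Definition 4.1] -/
theorem cosphereSecondMoment_eq_zero_of_eqOn (h : IsBurnettDefectDatum U (fun _ ↦ G₀) g μ)
    (hU : IsOpen U) (hg : EqOn g G₀ U) {φ : E → ℝ} (hφ : Continuous φ)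
    (hφc : HasCompactSupport φ) (hφU : tsupport φ ⊆ U) (v w : E) :
    cosphereSecondMoment μ φ v w = 0 := by
  have ht := h.tendsto_secondMoment φ hφ hφc hφU v w
  have h0 : (fun n : ℕ ↦ ∫ x, φ x *
      (MetricCoord.burnettForm g x (fderiv ℝ ((fun _ : ℕ ↦ G₀) n - g) x v)
        (fderiv ℝ ((fun _ : ℕ ↦ G₀) n - g) x w) * MetricCoord.volDensity g x)) = fun _ ↦ 0 := by
    funext n
    refine integral_eq_zero_of_ae (Eventually.of_forall fun x ↦ ?_)
    by_cases hx : x ∈ U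
    · have hev : (G₀ - g) =ᶠ[𝓝 x] fun _ ↦ (0 : E →L[ℝ] E →L[ℝ] ℝ) := by
        filter_upwards [hU.mem_nhds hx] with y hy
        simp [hg hy]
      have hfd : fderiv ℝ (G₀ - g) x = 0 := by
        rw [hev.fderiv_eq]
        exact fderiv_const_apply 0
      simp [hfd]
    · have hφx : φ x = 0 := image_eq_zero_of_notMem_tsupport fun h' ↦ hx (hφU h')
      simp [hφx]
  rw [h0] at ht
  exact tendsto_nhds_unique ht tendsto_const_nhds

/-- Hence the base marginal of the datum kills every admissible test function:
`∫ φ(x) dμ(x, ω) = 0` for `φ ∈ C_c(E)` supported in `U`. [cite: HuneauLuk2024wave, Definition 4.1] -/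
theorem integral_eq_zero_of_eqOn (h : IsBurnettDefectDatum U (fun _ ↦ G₀) g μ) (hU : IsOpen U)
    (hg : EqOn g G₀ U) {φ : E → ℝ} (hφ : Continuous φ) (hφc : HasCompactSupport φ)
    (hφU : tsupport φ ⊆ U) : ∫ p, φ p.1 ∂μ = 0 := by
  haveI := h.isFiniteMeasureOnCompacts
  rw [← sum_cosphereSecondMoment_eq_integral (stdOrthonormalBasis ℝ E) μ hφ hφc]
  exact Finset.sum_eq_zero fun i _ ↦ h.cosphereSecondMoment_eq_zero_of_eqOn hU hg hφ hφc hφU _ _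

/-- Hence the datum charges no compact part of `U × S(E)`. [cite: HuneauLuk2024wave, Definition 4.1] -/
theorem measure_prod_eq_zero_of_eqOn (h : IsBurnettDefectDatum U (fun _ ↦ G₀) g μ) (hU : IsOpen U)
    (hg : EqOn g G₀ U) {K : Set E} (hK : IsCompact K) (hKU : K ⊆ U) :
    μ (K ×ˢ (univ : Set (Metric.sphere (0 : E) 1))) = 0 := by
  haveI := h.isFiniteMeasureOnCompacts
  obtain ⟨V, hV, hKV, hVU, hVc⟩ := exists_open_between_and_isCompact_closure hK hU hKU
  obtain ⟨f, hfV, hf1, hf01⟩ := exists_tsupport_one_of_isOpen_isClosed hV hVc hK.isClosed hKV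
  have hfc : HasCompactSupport f :=
    IsCompact.of_isClosed_subset hVc (isClosed_tsupport _) (hfV.trans subset_closure)
  have hfU : tsupport f ⊆ U := hfV.trans (subset_closure.trans hVU)
  have hint : Integrable (fun p : E × Metric.sphere (0 : E) 1 ↦ f p.1) μ :=
    Continuous.integrable_of_hasCompactSupport (by fun_prop) (hasCompactSupport_comp_fst_cosphere hfc)
  have hmeas : Measurable fun p : E × Metric.sphere (0 : E) 1 ↦ ENNReal.ofReal (f p.1) :=
    (ENNReal.continuous_ofReal.comp (f.continuous.comp continuous_fst)).measurable
  refine nonpos_iff_eq_zero.1 ?_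
  calc μ (K ×ˢ (univ : Set (Metric.sphere (0 : E) 1)))
      = ∫⁻ _ in K ×ˢ (univ : Set (Metric.sphere (0 : E) 1)), 1 ∂μ := (setLIntegral_one _).symm
    _ ≤ ∫⁻ p in K ×ˢ (univ : Set (Metric.sphere (0 : E) 1)), ENNReal.ofReal (f p.1) ∂μ :=
        setLIntegral_mono hmeas fun p hp ↦ by simp [hf1 hp.1]
    _ ≤ ∫⁻ p, ENNReal.ofReal (f p.1) ∂μ := setLIntegral_le_lintegral _ _
    _ = ENNReal.ofReal (∫ p, f p.1 ∂μ) :=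
        (ofReal_integral_eq_lintegral_ofReal hint (ae_of_all _ fun p ↦ (hf01 p.1).1)).symm
    _ = 0 := by rw [h.integral_eq_zero_of_eqOn hU hg f.continuous hfc hfU, ENNReal.ofReal_zero]

/-- **A defect datum of a constant sequence is the zero measure** (open `U`, limit equal to the
constant on `U`): no oscillation, no effective matter (HL 2024, §1). [cite: HuneauLuk2024wave, Definition 4.1] -/
theorem eq_zero_of_eqOn (h : IsBurnettDefectDatum U (fun _ ↦ G₀) g μ) (hU : IsOpen U)
    (hg : EqOn g G₀ U) : μ = 0 := by
  -- a compact exhaustion of the open set `U` of the proper space `E`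
  obtain ⟨F, hFc, hFU, hFunion, hFmono⟩ := hU.exists_iUnion_isClosed
  have hunion : ⋃ n : ℕ, (F n ∩ Metric.closedBall (0 : E) n) = U := by
    refine Subset.antisymm (iUnion_subset fun n ↦ inter_subset_left.trans (hFU n)) fun x hx ↦ ?_
    rw [← hFunion] at hx
    obtain ⟨n₀, hn₀⟩ := mem_iUnion.1 hx
    obtain ⟨m, hm⟩ := exists_nat_ge ‖x‖
    refine mem_iUnion.2 ⟨max n₀ m, hFmono (le_max_left _ _) hn₀, ?_⟩
    rw [Metric.mem_closedBall, dist_zero_right]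
    exact hm.trans (by exact_mod_cast le_max_right n₀ m)
  have h1 : μ (U ×ˢ (univ : Set (Metric.sphere (0 : E) 1))) = 0 := by
    rw [← hunion, iUnion_prod_const]
    exact measure_iUnion_null fun n ↦ h.measure_prod_eq_zero_of_eqOn hU hg
      ((isCompact_closedBall _ _).of_isClosed_subset ((hFc n).inter Metric.isClosed_closedBall)
        inter_subset_right) (inter_subset_left.trans (hFU n))
  rw [← Measure.measure_univ_eq_zero, ← union_compl_self (U ×ˢ (univ : Set (Metric.sphere (0 : E) 1)))]
  exact measure_union_null h1 h.measure_compl_prod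

/-- In particular the datum of the constant sequence `gₙ = g₀` with limit `g₀` on an open set is
`0` (converse of `IsBurnettDefectDatum.zero_of_const`). [cite: HuneauLuk2024wave, Definition 4.1] -/
theorem eq_zero_of_const {g₀ : E → E →L[ℝ] E →L[ℝ] ℝ} (h : IsBurnettDefectDatum U (fun _ ↦ g₀) g₀ μ)
    (hU : IsOpen U) : μ = 0 :=
  h.eq_zero_of_eqOn hU (eqOn_refl _ _)

end IsBurnettDefectDatum

end Datum

/-! ### Consequence for late-time ω-limit sets of stationary charts -/

/-- The slab `S_L = {τ₀ < t < τ₀ + L}` of a background with continuous time function is open in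
`E4`. [folklore] -/
theorem ModelBackground.isOpen_image_timeSlabIoo (B : ModelBackground) (hB : Continuous B.time)
    (τ₀ L : ℝ) : IsOpen (Subtype.val '' B.timeSlabIoo τ₀ L) := by
  have h : Subtype.val '' B.timeSlabIoo τ₀ L = (B.domain : Set E4) ∩ B.time ⁻¹' Ioo τ₀ (τ₀ + L) := by
    ext x
    constructor
    · rintro ⟨y, hy, rfl⟩
      exact ⟨y.2, hy⟩
    · rintro ⟨hx, hx'⟩
      exact ⟨⟨x, hx⟩, hx', rfl⟩
  rw [h]
  exact B.domain.isOpen.inter (isOpen_Ioo.preimage hB)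

/-- **Stationary charts have the single late-time ω-limit `(G₀, 0)`**: if the translates
`g_T = (Ψ^* g)(· + T∂₀)` do not depend on `T` (`g_T = G₀` for all `T`), then every pair `(g, μ)` in
the late-time Burnett ω-limit set with defect measures on an open slab `S_L` satisfies `g = G₀` on
`S_L` and `μ = 0` — a stationary spacetime read through a stationary chart carries no effective
Vlasov matter (HL 2024, §1). [cite: HuneauLuk2024wave, Definition 4.1] -/
theorem Spacetime.eqOn_and_eq_zero_of_mem_lateTimeBurnettDefectOmegaLimitSet {𝓢 : Spacetime 4}
    {B : ModelBackground} {Ψ : B.domain → 𝓢.carrier} {τ₀ L : ℝ}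
    {G₀ : E4 → E4 →L[ℝ] E4 →L[ℝ] ℝ} (hS : IsOpen (Subtype.val '' B.timeSlabIoo τ₀ L))
    (hconst : ∀ T : ℝ, 𝓢.translatedChartMetric B Ψ T = G₀)
    {l : (E4 → E4 →L[ℝ] E4 →L[ℝ] ℝ) × Measure (E4 × Metric.sphere (0 : E4) 1)}
    (hl : l ∈ 𝓢.lateTimeBurnettDefectOmegaLimitSet B Ψ τ₀ L) :
    EqOn l.1 G₀ (Subtype.val '' B.timeSlabIoo τ₀ L) ∧ l.2 = 0 := by
  obtain ⟨T, -, hconv, hdat⟩ := hl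
  have hseq : 𝓢.translatedChartMetric B Ψ ∘ T = fun _ ↦ G₀ := funext fun n ↦ hconst (T n)
  rw [hseq] at hconv hdat
  have heq : EqOn l.1 G₀ (Subtype.val '' B.timeSlabIoo τ₀ L) := fun x hx ↦
    tendsto_nhds_unique (hconv.tendsto hx) tendsto_const_nhds
  exact ⟨heq, hdat.eq_zero_of_eqOn hS heq⟩

end Literature.Geometry.Lorentzian

end
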